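import Literature.Topology.FourManifolds.ExpHeightCritical
import Literature.Topology.FourManifolds.MorseDiscLemma
import Literature.Topology.FourManifolds.RegularLevelSplitting
import Literature.Topology.FourManifolds.MorseChartChange
import Literature.Topology.FourManifolds.MorseExtrema
import HarnessLib

/-!
# The exp-height device, ball form: a compact regular domain with a unique upward-normal
# boundary point is diffeomorphic to the closed ball

Topic `Literature/Topology/FourManifolds`; sequel of `ExpHeightCritical.lean` (fact seat
`provefact-Literature.Topology.FourManifolds.SphereEmbedding.schoenflies_exists_ball`).
**Everything in this file is proved; no definitions, no named facts.**

From the calculus theorem `ExpHeight.exists_unique_critical` (a rate `t`, a margin `η` and the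
unique critical point `x₀` — a nondegenerate minimum — of `G = e^{t⟪v,·⟫} F` in the open set
`U = {F < η} ∩ (1-thickening of {F ≤ 0})`) to the tree's Morse theory:

* `ExpHeight.isMCriticalPt_comp_val_iff`, `ExpHeight.nondegenerate_mhessian_comp_val` — on an
  open subset `U ⊆ ℝⁿ⁺¹` (Mathlib's open submanifold `TopologicalSpace.Opens`), the tree's
  `IsMCriticalPt`/`mhessian` of `G|U` are read off `DG`, `D²G` (the preferred chart of `U` is the
  inclusion near each point; `MorseChartChange.lean`);
* `ExpHeight.exists_regularSublevel_diffeomorph_closedBall` — **recognition theorem**: under the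
  hypotheses of `exists_unique_critical` and `F ∈ C^∞`, in dimension `n + 1 ≥ 2`, the set
  `{F ≤ 0}` — as the regular sublevel set `{G|U ≤ 0}`
  (`Literature.Topology.FourManifolds.RegularSublevel`, a compact manifold with boundary
  `{F = 0}`) — is diffeomorphic to the closed ball `𝔻ⁿ⁺¹`: `G|U` is Morse with `0` a regular
  level and exactly one critical point, a minimum (`IsLocalMin.morseIndex_eq_zero`), so
  `RegularSublevel.morseData` (Milnor 1963, Thm. 3.1) and
  `IsMorseAdapted.nonempty_diffeomorph_closedBall` (`MorseDiscLemma.lean`: Thm. 3.1 with the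
  Lemma of Morse) apply;
* `ExpHeight.exists_regularSublevel_diffeomorph_closedBall_of_pair` — **Schultens' case
  `n = 0` in region form**: if the boundary points with `DF ∥ ⟪v,·⟫` (the critical points of the
  height on the boundary) are among two points at which `D²F|vᗮ` is nondegenerate, then
  `{F ≤ 0} ≅ 𝔻ⁿ⁺¹` (Schultens (2014), proof of Thm. 3.2.5, case `n = 0`: a sphere whose height
  function has one maximum and one minimum bounds a ball; PDF p. 44 of the held copy).

What is NOT here (recorded for the seat): the passage from a smooth embedding
`f : 𝕊² → ℝ³` to a defining function `F` with `{F = 0} = range f` and the dictionary between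
the Morse data of the height `x₃ ∘ f` and the conditions on `DF`, `D²F|vᗮ` used above; and the
extension of the diffeomorphism `𝔻ⁿ⁺¹ ≅ {F ≤ 0}` to a smooth embedding of `ℝⁿ⁺¹` (the form of
`SphereEmbedding.schoenflies_exists_ball`).

## References

* J. Schultens, *Introduction to 3-Manifolds*, GSM 151 (2014), proof of Thm. 3.2.5, case
  `n = 0` (PDF p. 44 of the held copy). [Schultens2014]
* J. Milnor, *Morse theory*, Ann. of Math. Studies 51 (1963), Lemma 2.2, Thm. 3.1 and proof of
  Thm. 4.1. [Milnor1963]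

## Design notes

Pure theorems, no local notation: the model space is written `EuclideanSpace ℝ (Fin (n + 1))`
and the closed ball `Metric.closedBall (0 : EuclideanSpace ℝ (Fin (n + 1))) 1` with its
manifold-with-boundary structure `instChartedSpaceClosedBall` of `ClosedBall.lean`.
-/

open scoped RealInnerProductSpace Topology Manifold ContDiff
open Set Filter Metric

noncomputable section

namespace Literature.Topology.FourManifolds

namespace ExpHeight

/-! ### §9 From the calculus to the closed ball (bridge to the tree's Morse theory) -/

section Ball

variable {n : ℕ}

/-- On an open subset `U` of `ℝⁿ⁺¹`, a function `G ∘ Subtype.val` read in the preferred extended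
chart at `x` agrees with `G` near `x`. [folklore] -/
theorem comp_extend_symm_eventuallyEq {U : TopologicalSpace.Opens (EuclideanSpace ℝ (Fin (n + 1)))} (G : EuclideanSpace ℝ (Fin (n + 1)) → ℝ)
    (x : U) :
    ((fun y : U => G y) ∘ ((chartAt (EuclideanSpace ℝ (Fin (n + 1))) x).extend (𝓡 (n + 1))).symm) =ᶠ[𝓝 (x : EuclideanSpace ℝ (Fin (n + 1)))]
      G := by
  have h1 := TopologicalSpace.Opens.chartAt_subtype_val_symm_eventuallyEq (H := EuclideanSpace ℝ (Fin (n + 1))) U (x := x)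
  simp only [chartAt_self_eq, OpenPartialHomeomorph.refl_apply,
    OpenPartialHomeomorph.refl_symm] at h1
  filter_upwards [h1] with y hy
  simp only [Function.comp_apply, OpenPartialHomeomorph.extend_coe_symm,
    modelWithCornersSelf_coe_symm] at hy ⊢
  change G ((Subtype.val ∘ (chartAt (EuclideanSpace ℝ (Fin (n + 1))) x).symm) y) = G y
  exact congrArg G hy.symm

/-- The preferred extended chart of an open subset of `ℝⁿ⁺¹` sends `x` to `x`. [folklore] -/
theorem extend_apply_self {U : TopologicalSpace.Opens (EuclideanSpace ℝ (Fin (n + 1)))} (x : U) :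
    (chartAt (EuclideanSpace ℝ (Fin (n + 1))) x).extend (𝓡 (n + 1)) x = (x : EuclideanSpace ℝ (Fin (n + 1))) := by
  rw [OpenPartialHomeomorph.extend_coe, Function.comp_apply, modelWithCornersSelf_coe, id,
    TopologicalSpace.Opens.chartAt_eq, OpenPartialHomeomorph.subtypeRestr_coe]
  rfl

/-- **Critical points on an open subset of `ℝⁿ⁺¹`**: `x` is a critical point of `G|U` iff
`DG(x) = 0`. [folklore] -/
theorem isMCriticalPt_comp_val_iff {U : TopologicalSpace.Opens (EuclideanSpace ℝ (Fin (n + 1)))} {G : EuclideanSpace ℝ (Fin (n + 1)) → ℝ}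
    (hG : ContDiff ℝ 2 G) (x : U) :
    IsMCriticalPt (𝓡 (n + 1)) (fun y : U => G y) x ↔ fderiv ℝ G x = 0 := by
  have hf : ContMDiffAt (𝓡 (n + 1)) 𝓘(ℝ, ℝ) 2 (fun y : U => G y) x :=
    contMDiffAt_subtype_iff.2 (contMDiff_iff_contDiff.2 hG).contMDiffAt
  rw [isMCriticalPt_iff_fderiv_comp_extend_symm_eq_zero hf (IsManifold.chart_mem_maximalAtlas x)
    (mem_chart_source _ x), extend_apply_self, (comp_extend_symm_eventuallyEq G x).fderiv_eq]

/-- **The Hessian on an open subset of `ℝⁿ⁺¹`**: at a critical point of `G|U`, the tree's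
`mhessian` is nondegenerate as soon as `D²G(x)` is positive definite. [folklore] -/
theorem nondegenerate_mhessian_comp_val {U : TopologicalSpace.Opens (EuclideanSpace ℝ (Fin (n + 1)))}
    {G : EuclideanSpace ℝ (Fin (n + 1)) → ℝ} (hG : ContDiff ℝ 2 G) (x : U)
    (hx : IsMCriticalPt (𝓡 (n + 1)) (fun y : U => G y) x)
    (hpos : ∀ u, u ≠ 0 → 0 < fderiv ℝ (fderiv ℝ G) x u u) :
    (mhessian (𝓡 (n + 1)) (fun y : U => G y) x).Nondegenerate := by
  have hf : ContMDiffAt (𝓡 (n + 1)) 𝓘(ℝ, ℝ) 2 (fun y : U => G y) x :=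
    contMDiffAt_subtype_iff.2 (contMDiff_iff_contDiff.2 hG).contMDiffAt
  rw [nondegenerate_mhessian_iff hf hx (IsManifold.chart_mem_maximalAtlas x) (mem_chart_source _ x)]
  have key : ∀ u w, hessianInChart (𝓡 (n + 1)) (chartAt (EuclideanSpace ℝ (Fin (n + 1))) x) (fun y : U => G y) x u w =
      fderiv ℝ (fderiv ℝ G) x u w := by
    intro u w
    rw [hessianInChart_apply_apply, ModelWithCorners.Boundaryless.range_eq_univ, fderivWithin_univ,
      fderivWithin_univ, extend_apply_self, (comp_extend_symm_eventuallyEq G x).fderiv.fderiv_eq]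
  refine ⟨fun u hu => ?_, fun u hu => ?_⟩
  · by_contra h0
    have := hpos u h0
    rw [← key, hu u] at this
    exact lt_irrefl _ this
  · by_contra h0
    have := hpos u h0
    rw [← key, hu u] at this
    exact lt_irrefl _ this

/-- **The recognition theorem, manifold form.** Let `A = {F ≤ 0} ⊂ ℝⁿ⁺¹` (`n + 1 ≥ 2`) be a
compact regular domain presented by a `C^∞` function `F` with a unique upward-normal boundary
point at which the boundary is strictly convex (hypotheses of `exists_unique_critical`).  Then `A`,
with the manifold-with-boundary structure of a regular sublevel set of the tree
(`Literature.Topology.FourManifolds.RegularSublevel`, here of the exp-height modification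
`e^{t⟪v,·⟫} F` restricted to the open neighbourhood `U = {F < η} ∩ (1-thickening of A)`), is
diffeomorphic to the closed ball `𝔻ⁿ⁺¹`.  Proof: by `HasUniqueUpNormal.exists_unique_critical`
the restriction is a Morse function on `U` with `0` a regular level, `{· ≤ 0} = A` and exactly one
critical point, a nondegenerate minimum; the tree's `RegularSublevel.morseData` makes it a Morse
function adapted to the boundary of `A`, and `IsMorseAdapted.nonempty_diffeomorph_closedBall`
(Milnor 1963, Thm. 3.1 with the Lemma of Morse) concludes. [folklore] -/
theorem exists_regularSublevel_diffeomorph_closedBall {F : EuclideanSpace ℝ (Fin (n + 1)) → ℝ} {v p₀ : EuclideanSpace ℝ (Fin (n + 1))}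
    (hF : ContDiff ℝ ∞ F) (hK : IsCompact {x | F x ≤ 0})
    (hne : ∃ x, F x < 0) (hreg : ∀ x, F x = 0 → fderiv ℝ F x ≠ 0) (hv : v ≠ 0)
    (hp₀ : F p₀ = 0) (hup : ∃ c : ℝ, 0 < c ∧ fderiv ℝ F p₀ = c • innerSL ℝ v)
    (huniq : ∀ p, F p = 0 → (∃ c : ℝ, 0 < c ∧ fderiv ℝ F p = c • innerSL ℝ v) → p = p₀)
    (hpos : ∀ w, ⟪v, w⟫ = 0 → w ≠ 0 → 0 < fderiv ℝ (fderiv ℝ F) p₀ w w) (hn : 1 ≤ n) :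
    ∃ (U : TopologicalSpace.Opens (EuclideanSpace ℝ (Fin (n + 1)))) (f : U → ℝ)
      (h0 : IsRegularLevel (𝓡 (n + 1)) f 0),
      {x | F x ≤ 0} ⊆ (U : Set (EuclideanSpace ℝ (Fin (n + 1)))) ∧ (∀ x : U, f x ≤ 0 ↔ F x ≤ 0) ∧
      (∀ x : U, f x = 0 ↔ F x = 0) ∧
      Nonempty (RegularSublevel h0 ≃ₘ⟮𝓡∂ (n + 1), 𝓡∂ (n + 1)⟯ (Metric.closedBall (0 : EuclideanSpace ℝ (Fin (n + 1))) 1)) := by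
  have hF2 : ContDiff ℝ 2 F := hF.of_le (by norm_cast)
  obtain ⟨t, ht, η, hη, x₀, hFx₀, hcrit, hlocmin, hpos, huniq⟩ :=
    exists_unique_critical hF2 hK hne hreg hv hp₀ hup huniq hpos
  have hFc : Continuous F := hF.continuous
  have hFd : Differentiable ℝ F := hF.differentiable (by norm_num)
  set K : Set (EuclideanSpace ℝ (Fin (n + 1))) := {x | F x ≤ 0} with hKdef
  set G : EuclideanSpace ℝ (Fin (n + 1)) → ℝ := fun x => Real.exp (t * ⟪v, x⟫) * F x with hG
  have hGs : ContDiff ℝ ∞ G := contDiff_expHeight hF t v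
  have hG2 : ContDiff ℝ 2 G := contDiff_expHeight hF2 t v
  -- the open neighbourhood `U`
  set Us : Set (EuclideanSpace ℝ (Fin (n + 1))) := thickening 1 K ∩ F ⁻¹' Iio η with hUs
  have hUo : IsOpen Us := isOpen_thickening.inter (isOpen_Iio.preimage hFc)
  set U : TopologicalSpace.Opens (EuclideanSpace ℝ (Fin (n + 1))) := ⟨Us, hUo⟩ with hU
  have hKU : K ⊆ (U : Set (EuclideanSpace ℝ (Fin (n + 1)))) := fun x hx =>
    ⟨self_subset_thickening one_pos K hx, lt_of_le_of_lt (show F x ≤ 0 from hx) hη⟩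
  set f : U → ℝ := fun y => G y with hf
  have hfs : ContMDiff (𝓡 (n + 1)) 𝓘(ℝ, ℝ) ∞ f :=
    fun y => contMDiffAt_subtype_iff.2 (contMDiff_iff_contDiff.2 hGs).contMDiffAt
  -- critical points of `f`
  have hcritf : ∀ y : U, IsMCriticalPt (𝓡 (n + 1)) f y ↔ (y : EuclideanSpace ℝ (Fin (n + 1))) = x₀ := by
    intro y
    rw [isMCriticalPt_comp_val_iff hG2 y]
    refine ⟨fun hy => huniq y y.2.2 y.2.1 hy, fun hy => by rw [hy]; exact hcrit⟩
  -- `0` is a regular level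
  have h0 : IsRegularLevel (𝓡 (n + 1)) f 0 := by
    refine ⟨hfs, fun y _ => BoundarylessManifold.isInteriorPoint, fun y hy hyc => ?_⟩
    have hy0 : F y = 0 := (expHeight_eq_zero_iff t v F y).1 hy
    have := (hcritf y).1 hyc
    rw [this] at hy0
    exact hFx₀.ne hy0
  refine ⟨U, f, h0, hKU, fun y => expHeight_nonpos_iff t v F y, fun y => expHeight_eq_zero_iff t v F y,
    ?_⟩
  -- Morse
  have hMorse : IsMorse (𝓡 (n + 1)) f := by
    refine ⟨hfs, fun y hy => ?_⟩
    have hyx : (y : EuclideanSpace ℝ (Fin (n + 1))) = x₀ := (hcritf y).1 hy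
    refine nondegenerate_mhessian_comp_val hG2 y hy fun u hu => ?_
    rw [hyx]
    exact hpos u hu
  -- compactness
  have hKc : IsCompact (f ⁻¹' Iic 0) := by
    have himg : Subtype.val '' (f ⁻¹' Iic (0 : ℝ)) = K := by
      ext x
      simp only [mem_image, mem_preimage, mem_Iic, Subtype.exists, exists_and_right, exists_eq_right]
      constructor
      · rintro ⟨hx, hfx⟩
        exact (expHeight_nonpos_iff t v F x).1 hfx
      · intro hx
        exact ⟨hKU hx, (expHeight_nonpos_iff t v F x).2 hx⟩
    rw [Topology.IsEmbedding.subtypeVal.isCompact_iff, himg]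
    exact hK
  haveI : CompactSpace (RegularSublevel h0) := isCompact_iff_compactSpace.1 hKc
  -- the adapted Morse function and its unique critical point
  obtain ⟨hadapt, hiff, hind⟩ := RegularSublevel.morseData hMorse h0
  set p : RegularSublevel h0 := RegularSublevel.mk h0 ⟨x₀, hKU (le_of_lt hFx₀)⟩
    (le_of_lt ((expHeight_neg_iff t v F x₀).2 hFx₀)) with hp
  have hpcritM : IsMCriticalPt (𝓡 (n + 1)) f (RegularSublevel.incl h0 p) :=
    (hcritf _).2 rfl
  have hpcrit := (hiff p).2 hpcritM
  have hunique : ∀ q, IsMCriticalPt (𝓡∂ (n + 1))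
      (fun x : RegularSublevel h0 => f (RegularSublevel.incl h0 x) + (1 - 0)) q → q = p := by
    intro q hq
    have h1 := (hcritf _).1 ((hiff q).1 hq)
    apply RegularSublevel.injective_incl h0
    exact Subtype.ext h1
  have hind0 : morseIndex (𝓡∂ (n + 1))
      (fun x : RegularSublevel h0 => f (RegularSublevel.incl h0 x) + (1 - 0)) p = 0 := by
    rw [hind p hpcritM]
    have hlm : IsLocalMin f (RegularSublevel.incl h0 p) :=
      IsLocalMin.comp_continuous (f := G) (g := (Subtype.val : U → EuclideanSpace ℝ (Fin (n + 1))))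
        (b := RegularSublevel.incl h0 p) hlocmin continuous_subtype_val.continuousAt
    exact IsLocalMin.morseIndex_eq_zero ((hfs _).of_le (by norm_cast)) hlm
  exact IsMorseAdapted.nonempty_diffeomorph_closedBall hn hadapt hpcrit hunique hind0

/-- **Schultens' case `n = 0`, region form: a compact regular domain in `ℝⁿ⁺¹` (`n + 1 ≥ 2`)
whose boundary height function `⟪v, ·⟫` has at most two critical points, both nondegenerate,
is diffeomorphic to the closed ball.**  Precisely: `F` is `C^∞`, `A = {F ≤ 0}` is compact with
`{F < 0} ≠ ∅` and `DF ≠ 0` on `{F = 0}`; the boundary points at which `DF ∈ ℝ ⟪v, ·⟫` are among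
`p₁, p₂`, and at each of them `D²F` restricted to `vᗮ` is nondegenerate.  Then `A` (as a
regular sublevel set of the tree) is diffeomorphic to `𝔻ⁿ⁺¹`.  For a smooth `2`-sphere
`S ⊂ ℝ³` bounding `A` this is the case `n = 0` ("`h|S` has one maximum, one minimum and no saddle
… thus `S` bounds a `3`-ball") of the proof of the Schönflies theorem in Schultens (2014),
Thm. 3.2.5, here proved by the exp-height device instead of the stack-of-discs isotopy, so that
no `2`-dimensional Schönflies theorem is needed.
[cite: Schultens2014, proof of Thm. 3.2.5, case n = 0 (PDF p. 44)] -/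
theorem exists_regularSublevel_diffeomorph_closedBall_of_pair {F : EuclideanSpace ℝ (Fin (n + 1)) → ℝ}
    {v : EuclideanSpace ℝ (Fin (n + 1))} (hF : ContDiff ℝ ∞ F) (hK : IsCompact {x | F x ≤ 0})
    (hne : ∃ x, F x < 0) (hreg : ∀ x, F x = 0 → fderiv ℝ F x ≠ 0) (hv : v ≠ 0)
    {p₁ p₂ : EuclideanSpace ℝ (Fin (n + 1))}
    (hP : ∀ p, F p = 0 → (∃ c : ℝ, fderiv ℝ F p = c • innerSL ℝ v) → p = p₁ ∨ p = p₂)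
    (hnd : ∀ p, F p = 0 → (∃ c : ℝ, fderiv ℝ F p = c • innerSL ℝ v) →
      ∀ w, ⟪v, w⟫ = 0 → (∀ w', ⟪v, w'⟫ = 0 → fderiv ℝ (fderiv ℝ F) p w w' = 0) → w = 0)
    (hn : 1 ≤ n) :
    ∃ (U : TopologicalSpace.Opens (EuclideanSpace ℝ (Fin (n + 1)))) (f : U → ℝ)
      (h0 : IsRegularLevel (𝓡 (n + 1)) f 0),
      {x | F x ≤ 0} ⊆ (U : Set (EuclideanSpace ℝ (Fin (n + 1)))) ∧ (∀ x : U, f x ≤ 0 ↔ F x ≤ 0) ∧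
      (∀ x : U, f x = 0 ↔ F x = 0) ∧
      Nonempty (RegularSublevel h0 ≃ₘ⟮𝓡∂ (n + 1), 𝓡∂ (n + 1)⟯ (Metric.closedBall (0 : EuclideanSpace ℝ (Fin (n + 1))) 1)) := by
  obtain ⟨p₀, hp₀, hup, huniq, hpos⟩ :=
    exists_unique_upNormal_of_pair (hF.of_le (by norm_cast)) hK hne hreg hv hP hnd
  exact exists_regularSublevel_diffeomorph_closedBall hF hK hne hreg hv hp₀ hup huniq hpos hn

end Ball

end ExpHeight

end Literature.Topology.FourManifolds

end
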